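import Summits.Ventures.HodgeRepro2.T5SU11HardyInequality
import Summits.Ventures.HodgeRepro2.T5SU11HardyRemainder

/-!
# The ground-state identity with its remainder for `u = G_λ f`

Row 482 proved, for compactly supported `C¹` functions `u` on `(0, ∞)`, the ground-state identity
`‖u′‖² − ‖u‖² = ∫ sinh 2t (u′Ξ − uΞ′)²/Ξ²` in `L²((0, ∞), sinh 2t dt)` (`Ξ = φ_1`). Here the same identity is
proved for `u = G_λ f` — the resolvent `(L − λ(λ−2))⁻¹` applied to a continuous source `f` supported in
`[a, b] ⊂ (0, ∞)`, `λ > 1` — which is NOT compactly supported (`u = −c₁ φ_λ` on `(0, a]`, `u = −c₂ χ_λ` on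
`[b, ∞)`):

* the remainder integrand `r = sinh 2t ((G_λ f)′Ξ − (G_λ f)Ξ′)²/Ξ²` is non-negative (`remainder_nonneg`), continuous
  on `(0, ∞)` (`continuousOn_remainder`), agrees on `(0, a]` with a continuous function of `t ∈ ℝ`
  (`remainder_of_le`, `continuous_remainder_model`), hence is integrable on every `(0, R]`
  (`integrableOn_remainder_Ioc`) with `∫_0^ε r → 0` (`tendsto_integral_remainder_nhdsGT_zero`);
* row 477's identity on `[ε, R]` gives `∫_ε^R r = ∫_ε^R sinh 2t u′² − ∫_ε^R sinh 2t u² − (H(R) − H(ε))`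
  (`remainder_identity_interval`), `ε → 0⁺` gives `∫_0^R r = ∫_0^R sinh 2t u′² − ∫_0^R sinh 2t u² − H(R)`
  (`remainder_identity_finite`), and `R → ∞` (`H(R) → 0`, row 477; the `L²` integrability of rows 474–475) gives
  the convergence of `∫_0^R r` (`tendsto_integral_remainder_atTop`), hence — `r ≥ 0` — the integrability of `r` on
  `(0, ∞)` (`integrableOn_remainder`) and

  **`∫_0^∞ sinh 2t (G_λ f)′² − ∫_0^∞ sinh 2t (G_λ f)² = ∫_0^∞ sinh 2t ((G_λ f)′Ξ − (G_λ f)Ξ′)²/Ξ² ≥ 0`**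
  (`hardy_identity_resolvent`, `integral_remainder_nonneg`),

  the sharp form of row 478's Hardy inequality on the range of the resolvent: equality holds iff the remainder
  vanishes (`hardy_eq_iff`), i.e. iff `G_λ f/Ξ` is constant.

Nothing is claimed about (N).

Blind lane: Mathlib + the HodgeRepro2 prefix only; no sorry; axioms ⊆ {propext, Classical.choice,
Quot.sound}.
-/

namespace Summit.Ventures.HodgeRepro2.T5SU11HardyRemainderResolvent

open Filter Topology MeasureTheory intervalIntegral
open Set (Ioi Ioc Icc uIcc)
open T5SU11Cartan T5SU11SphericalFunction T5SU11SphericalBounds T5SU11SphericalContinuous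
  T5SU11SphericalSolutionSpaceAll T5SU11SphericalDecay T5SU11RadialGreen T5SU11SphericalGreen T5SU11ResolventTransform
  T5SU11ResolventEnergyPieces T5SU11ResolventEnergy T5SU11GroundStateTransform T5SU11HardyInequality
  T5SU11HardyCompactSupport

section measure

variable [MeasurableSpace Circle] [BorelSpace Circle]

/-! ### The remainder integrand -/

omit [BorelSpace Circle] in
/-- The remainder integrand `sinh 2t (u′Ξ − uΞ′)²/Ξ²` is non-negative for `t ≥ 0`. -/
theorem remainder_nonneg (u u' : ℝ → ℝ) {t : ℝ} (ht : 0 ≤ t) :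
    0 ≤ Real.sinh (2 * t) * (u' t * sph 1 (hyp t) - u t * deriv (fun t => sph 1 (hyp t)) t) ^ 2
      / sph 1 (hyp t) ^ 2 :=
  div_nonneg (mul_nonneg (Real.sinh_nonneg_iff.mpr (by linarith)) (sq_nonneg _)) (sq_nonneg _)

/-- The model of the remainder integrand on `(0, a]`: `sinh 2t (−c φ_λ′ Ξ + c φ_λ Ξ′)²/Ξ²` is continuous on `ℝ`. -/
theorem continuous_remainder_model (c lam : ℝ) :
    Continuous fun t => Real.sinh (2 * t) * ((-c * deriv (fun t => sph lam (hyp t)) t) * sph 1 (hyp t)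
      - (-c * sph lam (hyp t)) * deriv (fun t => sph 1 (hyp t)) t) ^ 2 / sph 1 (hyp t) ^ 2 := by
  have hΞ : Continuous fun t => sph 1 (hyp t) := continuous_sph_hyp 1
  have hΞ' : Continuous (deriv fun t => sph 1 (hyp t)) :=
    continuous_iff_continuousAt.mpr fun t => (hasDerivAt_deriv_sph_hyp 1 t).continuousAt
  have hφ : Continuous fun t => sph lam (hyp t) := continuous_sph_hyp lam
  have hφ' : Continuous (deriv fun t => sph lam (hyp t)) :=
    continuous_iff_continuousAt.mpr fun t => (hasDerivAt_deriv_sph_hyp lam t).continuousAt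
  refine ((Real.continuous_sinh.comp (continuous_const.mul continuous_id)).mul
    ((((continuous_const.mul hφ').mul hΞ).sub ((continuous_const.mul hφ).mul hΞ')).pow 2)).div
    (hΞ.pow 2) (fun t => ?_)
  exact pow_ne_zero 2 (sph_hyp_pos 1 t).ne'

variable {lam a b : ℝ} {f : ℝ → ℝ} (hlam : 1 < lam) (hf : ContinuousOn f (Ioi 0))
  (ha : 0 < a) (hab : a ≤ b) (hfa : ∀ s, s ≤ a → f s = 0) (hfb : ∀ s, b ≤ s → f s = 0)

include hlam hf ha hab in
/-- The remainder integrand of `u = G_λ f` is continuous on `(0, ∞)`. -/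
theorem continuousOn_remainder :
    ContinuousOn (fun t => Real.sinh (2 * t) * (sphGreen' lam f a b t * sph 1 (hyp t)
      - sphGreen lam f a b t * deriv (fun t => sph 1 (hyp t)) t) ^ 2 / sph 1 (hyp t) ^ 2) (Ioi 0) := by
  have hcu : ContinuousOn (sphGreen lam f a b) (Ioi 0) :=
    fun t ht => (hasDerivAt_sphGreen hlam hf ha hab ht).continuousAt.continuousWithinAt
  have hcu' : ContinuousOn (sphGreen' lam f a b) (Ioi 0) :=
    fun t ht => (hasDerivAt_sphGreen' hlam hf ha hab ht).continuousAt.continuousWithinAt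
  have hcs : ContinuousOn (fun t => Real.sinh (2 * t)) (Ioi 0) :=
    (Real.continuous_sinh.comp (continuous_const.mul continuous_id)).continuousOn
  have hΞ : Continuous fun t => sph 1 (hyp t) := continuous_sph_hyp 1
  have hΞ' : Continuous (deriv fun t => sph 1 (hyp t)) :=
    continuous_iff_continuousAt.mpr fun t => (hasDerivAt_deriv_sph_hyp 1 t).continuousAt
  refine (hcs.mul (((hcu'.mul hΞ.continuousOn).sub (hcu.mul hΞ'.continuousOn)).pow 2)).div
    (hΞ.continuousOn.pow 2) (fun t _ => ?_)
  exact pow_ne_zero 2 (sph_hyp_pos 1 t).ne'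

include hlam hf ha hab hfa in
/-- On `(0, a]`, where `G_λ f = −c₁ φ_λ`, the remainder integrand is the model of `continuous_remainder_model`. -/
theorem remainder_of_le {t : ℝ} (ht : 0 < t) (hta : t ≤ a) :
    Real.sinh (2 * t) * (sphGreen' lam f a b t * sph 1 (hyp t)
        - sphGreen lam f a b t * deriv (fun t => sph 1 (hyp t)) t) ^ 2 / sph 1 (hyp t) ^ 2
      = Real.sinh (2 * t) * ((-(∫ s in a..b, sphDecay lam s * f s * Real.sinh (2 * s))
            * deriv (fun t => sph lam (hyp t)) t) * sph 1 (hyp t)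
          - (-(∫ s in a..b, sphDecay lam s * f s * Real.sinh (2 * s)) * sph lam (hyp t))
            * deriv (fun t => sph 1 (hyp t)) t) ^ 2 / sph 1 (hyp t) ^ 2 := by
  obtain ⟨hu, hu'⟩ := sphGreen_of_le (lam := lam) (lam' := (1 + lam) / 2) (by linarith) (by linarith)
    hf ha hab hfa ht hta
  rw [hu, hu']

include hlam hf ha hab hfa in
/-- **The remainder integrand is integrable on every `(0, R]`.** -/
theorem integrableOn_remainder_Ioc (R : ℝ) :
    IntegrableOn (fun t => Real.sinh (2 * t) * (sphGreen' lam f a b t * sph 1 (hyp t)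
      - sphGreen lam f a b t * deriv (fun t => sph 1 (hyp t)) t) ^ 2 / sph 1 (hyp t) ^ 2) (Ioc 0 R) := by
  have hg := continuous_remainder_model (∫ s in a..b, sphDecay lam s * f s * Real.sinh (2 * s)) lam
  have hI1 : IntegrableOn (fun t => Real.sinh (2 * t) * (sphGreen' lam f a b t * sph 1 (hyp t)
      - sphGreen lam f a b t * deriv (fun t => sph 1 (hyp t)) t) ^ 2 / sph 1 (hyp t) ^ 2) (Ioc 0 a) := by
    refine (hg.integrableOn_Icc.mono_set Set.Ioc_subset_Icc_self).congr_fun (fun t ht => ?_) measurableSet_Ioc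
    exact (remainder_of_le hlam hf ha hab hfa ht.1 ht.2).symm
  have hI2 : IntegrableOn (fun t => Real.sinh (2 * t) * (sphGreen' lam f a b t * sph 1 (hyp t)
      - sphGreen lam f a b t * deriv (fun t => sph 1 (hyp t)) t) ^ 2 / sph 1 (hyp t) ^ 2) (Ioc a R) :=
    (((continuousOn_remainder hlam hf ha hab).mono
      (fun t ht => lt_of_lt_of_le ha ht.1)).integrableOn_Icc).mono_set Set.Ioc_subset_Icc_self
  rcases le_or_gt a R with haR | haR
  · have := hI1.union hI2
    rwa [Set.Ioc_union_Ioc_eq_Ioc ha.le haR] at this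
  · exact hI1.mono_set (Set.Ioc_subset_Ioc_right haR.le)

include hlam hf ha hab hfa in
/-- **`∫_0^ε r → 0` as `ε → 0⁺`.** -/
theorem tendsto_integral_remainder_nhdsGT_zero :
    Tendsto (fun ε => ∫ t in (0 : ℝ)..ε, Real.sinh (2 * t) * (sphGreen' lam f a b t * sph 1 (hyp t)
      - sphGreen lam f a b t * deriv (fun t => sph 1 (hyp t)) t) ^ 2 / sph 1 (hyp t) ^ 2) (𝓝[>] 0) (𝓝 0) :=
  tendsto_integral_nhdsGT_zero_of_eqOn
    (continuous_remainder_model (∫ s in a..b, sphDecay lam s * f s * Real.sinh (2 * s)) lam) ha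
    (fun _ ht hta => remainder_of_le hlam hf ha hab hfa ht hta)

/-! ### The identity on `[ε, R]`, on `[0, R]`, and on `(0, ∞)` -/

include hlam hf ha hab in
/-- **`∫_ε^R r = ∫_ε^R sinh 2t u′² − ∫_ε^R sinh 2t u² − (H(R) − H(ε))`** for `u = G_λ f` (row 477's identity). -/
theorem remainder_identity_interval {ε R : ℝ} (hε : 0 < ε) (hεR : ε ≤ R) :
    ∫ t in ε..R, Real.sinh (2 * t) * (sphGreen' lam f a b t * sph 1 (hyp t)
        - sphGreen lam f a b t * deriv (fun t => sph 1 (hyp t)) t) ^ 2 / sph 1 (hyp t) ^ 2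
      = (∫ t in ε..R, Real.sinh (2 * t) * sphGreen' lam f a b t ^ 2)
        - (∫ t in ε..R, Real.sinh (2 * t) * sphGreen lam f a b t ^ 2)
        - (hardyBracket (sphGreen lam f a b) R - hardyBracket (sphGreen lam f a b) ε) := by
  have hR : 0 < R := lt_of_lt_of_le hε hεR
  have hsub : uIcc ε R ⊆ Ioi 0 := uIcc_subset_Ioi hε hR
  have hA : IntervalIntegrable (fun t => Real.sinh (2 * t) * sphGreen' lam f a b t ^ 2) volume ε R :=
    ((continuousOn_sinh_mul_sphGreen'_sq hlam hf ha hab).mono hsub).intervalIntegrable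
  have hB : IntervalIntegrable (fun t => Real.sinh (2 * t) * sphGreen lam f a b t ^ 2) volume ε R :=
    ((continuousOn_sinh_mul_sphGreen_sq hlam hf ha hab).mono hsub).intervalIntegrable
  have hQ : IntervalIntegrable (fun t => Real.sinh (2 * t) * (sphGreen' lam f a b t * sph 1 (hyp t)
      - sphGreen lam f a b t * deriv (fun t => sph 1 (hyp t)) t) ^ 2 / sph 1 (hyp t) ^ 2) volume ε R :=
    ((continuousOn_remainder hlam hf ha hab).mono hsub).intervalIntegrable
  have h := hardy_identity_inhom (fun t ht => hasDerivAt_sphGreen hlam hf ha hab ht)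
    (fun t ht => (hasDerivAt_sphGreen' hlam hf ha hab ht).continuousAt.continuousWithinAt) hε hεR
  rw [integral_sub (hA.sub hB) hQ, integral_sub hA hB] at h
  linarith

include hlam hf ha hab hfa in
/-- **`∫_0^R r = ∫_0^R sinh 2t u′² − ∫_0^R sinh 2t u² − H(R)`** for `a ≤ R` (`ε → 0⁺`). -/
theorem remainder_identity_finite {R : ℝ} (haR : a ≤ R) :
    ∫ t in (0 : ℝ)..R, Real.sinh (2 * t) * (sphGreen' lam f a b t * sph 1 (hyp t)
        - sphGreen lam f a b t * deriv (fun t => sph 1 (hyp t)) t) ^ 2 / sph 1 (hyp t) ^ 2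
      = (∫ t in (0 : ℝ)..R, Real.sinh (2 * t) * sphGreen' lam f a b t ^ 2)
        - (∫ t in (0 : ℝ)..R, Real.sinh (2 * t) * sphGreen lam f a b t ^ 2)
        - hardyBracket (sphGreen lam f a b) R := by
  have hR : 0 < R := lt_of_lt_of_le ha haR
  have hAint : ∀ c, 0 ≤ c →
      IntervalIntegrable (fun t => Real.sinh (2 * t) * sphGreen' lam f a b t ^ 2) volume 0 c := fun c hc =>
    (intervalIntegrable_iff_integrableOn_Ioc_of_le hc).mpr (integrableOn_sinh_mul_sphGreen'_sq_Ioc hlam hf ha hab hfa c)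
  have hBint : ∀ c, 0 ≤ c →
      IntervalIntegrable (fun t => Real.sinh (2 * t) * sphGreen lam f a b t ^ 2) volume 0 c := fun c hc =>
    (intervalIntegrable_iff_integrableOn_Ioc_of_le hc).mpr (integrableOn_sinh_mul_sphGreen_sq_Ioc hlam hf ha hab hfa c)
  have hQint : ∀ c, 0 ≤ c → IntervalIntegrable (fun t => Real.sinh (2 * t) * (sphGreen' lam f a b t * sph 1 (hyp t)
      - sphGreen lam f a b t * deriv (fun t => sph 1 (hyp t)) t) ^ 2 / sph 1 (hyp t) ^ 2) volume 0 c := fun c hc =>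
    (intervalIntegrable_iff_integrableOn_Ioc_of_le hc).mpr (integrableOn_remainder_Ioc hlam hf ha hab hfa c)
  -- the left side as `ε → 0⁺`
  have hl : Tendsto (fun ε => ∫ t in ε..R, Real.sinh (2 * t) * (sphGreen' lam f a b t * sph 1 (hyp t)
      - sphGreen lam f a b t * deriv (fun t => sph 1 (hyp t)) t) ^ 2 / sph 1 (hyp t) ^ 2) (𝓝[>] 0)
      (𝓝 ((∫ t in (0 : ℝ)..R, Real.sinh (2 * t) * (sphGreen' lam f a b t * sph 1 (hyp t)
        - sphGreen lam f a b t * deriv (fun t => sph 1 (hyp t)) t) ^ 2 / sph 1 (hyp t) ^ 2) - 0)) := by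
    refine (tendsto_const_nhds.sub (tendsto_integral_remainder_nhdsGT_zero hlam hf ha hab hfa)).congr' ?_
    filter_upwards [Ioo_mem_nhdsGT ha] with ε hε
    exact integral_interval_sub_left (hQint R hR.le) (hQint ε hε.1.le)
  -- the right side as `ε → 0⁺`
  have hr : Tendsto (fun ε => (∫ t in ε..R, Real.sinh (2 * t) * sphGreen' lam f a b t ^ 2)
        - (∫ t in ε..R, Real.sinh (2 * t) * sphGreen lam f a b t ^ 2)
        - (hardyBracket (sphGreen lam f a b) R - hardyBracket (sphGreen lam f a b) ε)) (𝓝[>] 0)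
      (𝓝 (((∫ t in (0 : ℝ)..R, Real.sinh (2 * t) * sphGreen' lam f a b t ^ 2) - 0)
        - ((∫ t in (0 : ℝ)..R, Real.sinh (2 * t) * sphGreen lam f a b t ^ 2) - 0)
        - (hardyBracket (sphGreen lam f a b) R - 0))) := by
    refine (((tendsto_const_nhds.sub (tendsto_integral_sinh_mul_sphGreen'_sq_nhdsGT_zero hlam hf ha hab hfa)).sub
      (tendsto_const_nhds.sub (tendsto_integral_sinh_mul_sphGreen_sq_nhdsGT_zero hlam hf ha hab hfa))).sub
      (tendsto_const_nhds.sub (tendsto_hardyBracket_left hlam hf ha hab hfa))).congr' ?_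
    filter_upwards [Ioo_mem_nhdsGT ha] with ε hε
    rw [integral_interval_sub_left (hAint R hR.le) (hAint ε hε.1.le),
      integral_interval_sub_left (hBint R hR.le) (hBint ε hε.1.le)]
  have heq : (fun ε => ∫ t in ε..R, Real.sinh (2 * t) * (sphGreen' lam f a b t * sph 1 (hyp t)
      - sphGreen lam f a b t * deriv (fun t => sph 1 (hyp t)) t) ^ 2 / sph 1 (hyp t) ^ 2)
      =ᶠ[𝓝[>] 0] (fun ε => (∫ t in ε..R, Real.sinh (2 * t) * sphGreen' lam f a b t ^ 2)
        - (∫ t in ε..R, Real.sinh (2 * t) * sphGreen lam f a b t ^ 2)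
        - (hardyBracket (sphGreen lam f a b) R - hardyBracket (sphGreen lam f a b) ε)) := by
    filter_upwards [Ioo_mem_nhdsGT ha] with ε hε
    exact remainder_identity_interval hlam hf ha hab hε.1 (le_trans hε.2.le haR)
  have := tendsto_nhds_unique (hl.congr' heq) hr
  simpa only [sub_zero] using this

include hlam hf ha hab hfa hfb in
/-- **`∫_0^R r → ‖(G_λ f)′‖² − ‖G_λ f‖²` as `R → ∞`** (`H(R) → 0`, row 477). -/
theorem tendsto_integral_remainder_atTop :
    Tendsto (fun R => ∫ t in (0 : ℝ)..R, Real.sinh (2 * t) * (sphGreen' lam f a b t * sph 1 (hyp t)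
      - sphGreen lam f a b t * deriv (fun t => sph 1 (hyp t)) t) ^ 2 / sph 1 (hyp t) ^ 2) atTop
      (𝓝 ((∫ t in Ioi 0, Real.sinh (2 * t) * sphGreen' lam f a b t ^ 2)
        - (∫ t in Ioi 0, Real.sinh (2 * t) * sphGreen lam f a b t ^ 2) - 0)) := by
  have hA := intervalIntegral_tendsto_integral_Ioi 0 (integrableOn_sinh_mul_sphGreen'_sq hlam hf ha hab hfa hfb)
    (tendsto_id (x := atTop))
  have hB := intervalIntegral_tendsto_integral_Ioi 0 (integrableOn_sinh_mul_sphGreen_sq hlam hf ha hab hfa hfb)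
    (tendsto_id (x := atTop))
  refine ((hA.sub hB).sub (tendsto_hardyBracket_right hlam hf ha hab hfb)).congr' ?_
  filter_upwards [eventually_ge_atTop a] with R hR
  simpa only [id] using (remainder_identity_finite hlam hf ha hab hfa hR).symm

include hlam hf ha hab hfa hfb in
/-- **The remainder integrand is integrable on `(0, ∞)`** (non-negative with a convergent integral). -/
theorem integrableOn_remainder :
    IntegrableOn (fun t => Real.sinh (2 * t) * (sphGreen' lam f a b t * sph 1 (hyp t)
      - sphGreen lam f a b t * deriv (fun t => sph 1 (hyp t)) t) ^ 2 / sph 1 (hyp t) ^ 2) (Ioi 0) := by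
  refine integrableOn_Ioi_of_intervalIntegral_norm_tendsto
    ((∫ t in Ioi 0, Real.sinh (2 * t) * sphGreen' lam f a b t ^ 2)
        - (∫ t in Ioi 0, Real.sinh (2 * t) * sphGreen lam f a b t ^ 2) - 0) 0
    (fun R => integrableOn_remainder_Ioc hlam hf ha hab hfa R) (tendsto_id (x := atTop)) ?_
  refine (tendsto_integral_remainder_atTop hlam hf ha hab hfa hfb).congr' ?_
  filter_upwards [eventually_ge_atTop 0] with R hR
  refine integral_congr (fun t ht => ?_)
  rw [Set.uIcc_of_le hR] at ht
  rw [Real.norm_eq_abs, abs_of_nonneg (remainder_nonneg _ _ ht.1)]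

include hlam hf ha hab hfa hfb in
/-- **THE GROUND-STATE IDENTITY FOR `u = G_λ f`**: `‖(G_λ f)′‖² − ‖G_λ f‖² = ∫_0^∞ sinh 2t ((G_λ f)′Ξ − (G_λ f)Ξ′)²/Ξ²`
in `L²((0, ∞), sinh 2t dt)`, for every `λ > 1`. -/
theorem hardy_identity_resolvent :
    (∫ t in Ioi 0, Real.sinh (2 * t) * sphGreen' lam f a b t ^ 2)
        - (∫ t in Ioi 0, Real.sinh (2 * t) * sphGreen lam f a b t ^ 2)
      = ∫ t in Ioi 0, Real.sinh (2 * t) * (sphGreen' lam f a b t * sph 1 (hyp t)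
          - sphGreen lam f a b t * deriv (fun t => sph 1 (hyp t)) t) ^ 2 / sph 1 (hyp t) ^ 2 := by
  have h1 := intervalIntegral_tendsto_integral_Ioi 0 (integrableOn_remainder hlam hf ha hab hfa hfb)
    (tendsto_id (x := atTop))
  have h2 := tendsto_integral_remainder_atTop hlam hf ha hab hfa hfb
  have := tendsto_nhds_unique h1 h2
  rw [sub_zero] at this
  exact this.symm

omit [BorelSpace Circle] in
/-- **The remainder is non-negative.** -/
theorem integral_remainder_nonneg (lam a b : ℝ) (f : ℝ → ℝ) :
    0 ≤ ∫ t in Ioi 0, Real.sinh (2 * t) * (sphGreen' lam f a b t * sph 1 (hyp t)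
          - sphGreen lam f a b t * deriv (fun t => sph 1 (hyp t)) t) ^ 2 / sph 1 (hyp t) ^ 2 :=
  setIntegral_nonneg measurableSet_Ioi (fun _ ht => remainder_nonneg _ _ (le_of_lt ht))

include hlam hf ha hab hfa hfb in
/-- **Row 478's Hardy inequality, re-derived from the identity**: `‖G_λ f‖² ≤ ‖(G_λ f)′‖²`. -/
theorem hardy_inequality_of_identity :
    ∫ t in Ioi 0, Real.sinh (2 * t) * sphGreen lam f a b t ^ 2
      ≤ ∫ t in Ioi 0, Real.sinh (2 * t) * sphGreen' lam f a b t ^ 2 := by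
  have h := hardy_identity_resolvent hlam hf ha hab hfa hfb
  have h0 := integral_remainder_nonneg lam a b f
  linarith

include hlam hf ha hab hfa hfb in
/-- **Equality in Hardy iff the remainder vanishes**: `‖G_λ f‖² = ‖(G_λ f)′‖²` iff
`∫_0^∞ sinh 2t ((G_λ f)′Ξ − (G_λ f)Ξ′)²/Ξ² = 0`. -/
theorem hardy_eq_iff :
    (∫ t in Ioi 0, Real.sinh (2 * t) * sphGreen lam f a b t ^ 2)
        = ∫ t in Ioi 0, Real.sinh (2 * t) * sphGreen' lam f a b t ^ 2
      ↔ ∫ t in Ioi 0, Real.sinh (2 * t) * (sphGreen' lam f a b t * sph 1 (hyp t)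
          - sphGreen lam f a b t * deriv (fun t => sph 1 (hyp t)) t) ^ 2 / sph 1 (hyp t) ^ 2 = 0 := by
  rw [← hardy_identity_resolvent hlam hf ha hab hfa hfb]
  constructor <;> intro h <;> linarith

end measure

end Summit.Ventures.HodgeRepro2.T5SU11HardyRemainderResolvent
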